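import Summits.QuantumFields.YangMills.Theorems.UnitScaleTiltProp7ChartSigmaT3Descent
import Literature.MathematicalPhysics.QuantumFieldTheory.Balaban1983to89.B8Prop7AdmittedFamily
import Literature.MathematicalPhysics.QuantumFieldTheory.Balaban1983to89.B7AvgClosedSpecialUnitarySharp
import Literature.MathematicalPhysics.QuantumFieldTheory.Balaban1983to89.B10Eq29TubeLine
import HarnessLib

/-!
# `UnitScaleTiltProp7ChartSigmaT3GlevSU` — (σ-desc), SECOND HALF: THE (81)-NORMALISED AXIAL GAUGE FIXING `glev` OF [Balaban1985Averaging] §C IS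
# `SU(N)`-VALUED (N ≤ 21) FOR `SU(N)`-VALUED DATA IN THE PROP. 7 WINDOWS OF [Balaban1985RegularSpaces] — the determinant upgrade of lit-balaban r05's
# unitarity tower `B8Prop7AdmittedFamily.glev_mem_unitaryUnits` — HENCE (σ1) AND THE Σ_k BRIDGE AT THE T³ OBJECTS UNDER THOSE WINDOWS
# (route `UnitScaleTilt`, crux K1 «MinimiserStabilityRegPr» stmt-QuantumFields-19200, stub `stub_existenceMinimalOrbit`, route (α), (S3)(i) `ChartSigmaT3`;
# OWNER RULING g25-№3 §3(a); def-free, count-neutral)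

Cell `ym3-torus` (HUMAN RULING D-0037, YM ladder rung R3 — YM₃ on T³ is a rung, not d = 4, not a mass gap, not Clay).

WHY.  `Prop7ChartSigmaT3Descent` (p598959) left ONE displayed letter (S) in the Σ_k bridge: «`glev` of the based pullbacks is `SU(2)`-valued».  r05's
`B8Prop7AdmittedFamily` ([B8] Prop. 7 on print's ADMITTED family «Ω_j = T_η for all j» — the pure small-field problem of R3) proves the whole tower
UNITARY (`tHol`∕`wframe`∕`dbavgCovIter`∕`vcov`∕`glev` `∈ U(𝔸)`) under the explicit windows of its `Tower` section ((1.139) `pdev U₀ < α₀L^{−2k}`, `U₁ = e^{B}`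
with `‖B‖ ≤ b`, `2048·d·Lᵏb ≤ 1`, the Prop-2∕Prop-4 windows).  THIS FILE adds the DETERMINANT: every exp-mean-log factor `exp[Σ_r L^{−d} log W_r]` has
`det = exp Σ_r L^{−d} Tr log W_r = 1` because `Tr log W = 0` for `W ∈ SU(N)` within `¼` of `1` and `N·(−log ¾) < 2π`
(`B7AvgClosedSpecialUnitarySharp.trace_mlog_eq_zero_of_neg_log`, Route A, `N ≤ 21`), and the plain averages (43) stay in `SU(N)` by
`avgClosed_specialUnitary_of_le_twentyone`.

WHAT IS PROVED (sorry-free, no definition; `𝔸 = M_N(ℂ)` with the `L²`-operator norm, `N ≤ 21`; the windows are r05's `Tower` binders VERBATIM):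
* §1 `Rc_mem_specialUnitaryUnits`, `tHol_mem_specialUnitaryUnits`, **`wframe_mem_specialUnitaryUnits`** (the block frame (82) is in `SU(N)` when its twisted transports are
  within `¼` of `1`), `avgIter_mem_specialUnitaryUnits`, `avgIter_mul_mem_specialUnitaryUnits`;
* §2 **`dbavgCovIter_vcov_mem_specialUnitaryUnits`**, ★**`glev_mem_specialUnitaryUnits`** — print's gauge transformation `u` ((77) + (87)) is `SU(N)`-valued at every level;
* §3 AT THE T³ OBJECTS (`SU(2)`, `d = 3`, based pullbacks at `x₀ = Prop7SPrint.basePt F n K`, `k = K − n`): `pull_eq_expCfg_of_exp` (`U₁♯ = expCfg (I•X♯)` for `U₁ = e^{iX}`),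
  ★★**`exists_restrictedAxial_of_windows`** — (σ1): under the windows read on the pullbacks there is a torus gauge transformation `u` with `RestrictedPrint F n K U₀ u`
  and `IsAxialPrint F n K U₀ ((U₁U₀)^u)` (`Prop7ChartSigmaT3Descent.exists_restrictedAxial_of_glev_mem` ∘ §2); ★★**`avgCondPrint_of_windows_of_eq137cov`** — print's (20)
  in surface form `Prop7SPrint.AvgCondPrint F n K h V U₀ X` from the windows and the equation (1.37)^cov ALONE (no gauge-fixing letter displayed any more).
HONEST FRAMING.  The windows are DISPLAYED numerically exactly as r05 states them ((1.139) for `U₀♯` — at T³ it follows from `RegPr` by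
`Prop7AxialReprPrint.inAk_pull_of_regPr`∕`pdev_pull_lt`, not composed here; (1.141) for `U₁U₀`; `‖X‖ ≤ b` with `2048·3·L^{K−n}b ≤ 1` = the size (19) of the chart's
exponent; `hsmall`, `hc₃`); nothing of print is asserted; `--supports stmt-QuantumFields-19200 --as helper`.

References: T. Bałaban, CMP 98 (1985) 17–51 [Balaban1985Averaging] ((20)–(26) pp.21–22, (42)–(43) pp.23–24, (76)–(88) pp.30–31, (159)–(162) p.42); CMP 99 (1985) 75–102
[Balaban1985RegularSpaces] (Prop. 7, (1.139)–(1.145) p.100, (1.19) p.79, (1.29) p.81); CMP 102 (1985) 277–309 [Balaban1985Variational] ((19)–(20) p.281, p.299).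
-/

set_option autoImplicit false

noncomputable section

namespace Summit.QuantumFields.YangMills.Theorems.Prop7ChartSigmaT3GlevSU

open scoped Matrix.Norms.L2Operator BigOperators
open NormedSpace Finset
open Literature.MathematicalPhysics.QuantumFieldTheory.Balaban1983to89
open B7Prop1Explicit renaming Site → LSite
open B7Prop1Explicit (Letter hol treeWord boxVec e expUnit val_expUnit bavg)
open B7Prop2Explicit (avgIter pdev C0 c2' avgIter_mem hol_mem_of)
open B7Prop2SpecialUnitary (specialUnitaryUnits mem_specialUnitaryUnits specialUnitaryUnits_le_unitaryUnits)
open B7Prop3Flat (expCfg c3)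
open MatrixLog (mlog exp_mlog)
open B7Eq92Concrete (Rc Rc_apply mgauge tHol tild tild_apply tildIter tildIter_mul tildIter_eq_mgauge Fcov wframe dbavgCov dbavgCov_apply
  dbavgCovIter dbavgCovIter_zero dbavgCovIter_succ vcov vcov_zero vcov_succ)
open B7Eq99Concrete (wrec wrec_eq_vcov)
open B7Eq84Concrete (glev glev_top glev_of_lt)
open B7AvgClosedSpecialUnitarySharp (trace_mlog_eq_zero_of_neg_log avgClosed_specialUnitary_of_le_twentyone)
open B8Prop7AdmittedFamily (wframe_mem_unitaryUnits tild_eq_of_mgauge twist_le_quarter)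
open B8Ineq130 (fl)
open Literature.Analysis.Matrix (det_exp_eq_exp_trace)

variable {d : ℕ} {N : ℕ}

/-! ## §0 Numerics: `N·(−log ¾) < 2π` for `N ≤ 21` -/

/-- `−log(3/4) ≤ 7/24` (third Taylor remainder; the Sharp file's private lemma, re-proved). [folklore] -/
private theorem neg_log_three_quarters_le : -Real.log (1 - 1 / 4) ≤ 7 / 24 := by
  have hx : |(1 / 4 : ℝ)| < 1 := by rw [abs_of_pos (by norm_num)]; norm_num
  have h := Real.abs_log_sub_add_sum_range_le hx 3
  rw [abs_of_pos (by norm_num : (0 : ℝ) < 1 / 4)] at h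
  have h' := (abs_le.1 h).1
  simp only [Finset.sum_range_succ, Finset.sum_range_zero] at h'
  norm_num at h'
  linarith

/-- `x ↦ −log(1 − x)` is monotone on `x < 1`. [folklore] -/
private theorem neg_log_one_sub_mono {s t : ℝ} (hst : s ≤ t) (ht : t < 1) : -Real.log (1 - s) ≤ -Real.log (1 - t) := by
  have := Real.log_le_log (by linarith) (by linarith : 1 - t ≤ 1 - s)
  linarith

/-- **Route A window**: `N·(−log(1 − t)) < 2π` for `t ≤ ¼`, `N ≤ 21`. [cite: Balaban1985Averaging, (26) p.22] -/
theorem card_mul_neg_log_lt_two_pi (hN : N ≤ 21) {t : ℝ} (ht : t ≤ 1 / 4) :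
    (Fintype.card (Fin N) : ℝ) * (-Real.log (1 - t)) < 2 * Real.pi := by
  have hN' : (N : ℝ) ≤ 21 := by exact_mod_cast hN
  have hl := neg_log_three_quarters_le
  have hl0 : 0 ≤ -Real.log (1 - 1 / 4) := by
    have := Real.log_le_sub_one_of_pos (by norm_num : (0 : ℝ) < 1 - 1 / 4)
    linarith
  have hmono := neg_log_one_sub_mono ht (by norm_num)
  rw [Fintype.card_fin]
  have hN0 : (0 : ℝ) ≤ N := Nat.cast_nonneg _
  nlinarith [Real.pi_gt_d2, mul_le_mul hN' hl hl0 (by norm_num : (0 : ℝ) ≤ 21), mul_le_mul_of_nonneg_left hmono hN0]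

/-! ## §1 The `SU(N)` letters: rotations, twisted transports, the block frame (82), the averages (43) -/

/-- The rotation (56) `R(X)Y = XYX⁻¹` keeps `SU(N)` invariant. [cite: Balaban1985Averaging, (56) p.27] -/
theorem Rc_mem_specialUnitaryUnits {X Y : (Matrix (Fin N) (Fin N) ℂ)ˣ} (hX : X ∈ specialUnitaryUnits (Fin N)) (hY : Y ∈ specialUnitaryUnits (Fin N)) :
    Rc X Y ∈ specialUnitaryUnits (Fin N) := by
  rw [Rc_apply]
  exact (specialUnitaryUnits (Fin N)).mul_mem ((specialUnitaryUnits (Fin N)).mul_mem hX hY) ((specialUnitaryUnits (Fin N)).inv_mem hX)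

/-- The twisted transport (58) of `SU(N)`-valued `V₀`, `W` is in `SU(N)`. [cite: Balaban1985Averaging, (58) p.27] -/
theorem tHol_mem_specialUnitaryUnits {V₀ W : LSite d → Fin d → (Matrix (Fin N) (Fin N) ℂ)ˣ} (hV₀ : ∀ x κ, V₀ x κ ∈ specialUnitaryUnits (Fin N))
    (hW : ∀ x κ, W x κ ∈ specialUnitaryUnits (Fin N)) (y : LSite d) (w : List (Letter d)) :
    tHol V₀ W y w ∈ specialUnitaryUnits (Fin N) := by
  unfold tHol
  refine (specialUnitaryUnits (Fin N)).mul_mem (hol_mem_of (fun x κ => ?_) y w) ((specialUnitaryUnits (Fin N)).inv_mem (hol_mem_of hV₀ y w))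
  rw [Pi.mul_apply]
  exact (specialUnitaryUnits (Fin N)).mul_mem (hW x κ) (hV₀ x κ)

/-- **THE BLOCK FRAME (82) IS IN `SU(N)`** when `V₀`, `W` are `SU(N)`-valued and its twisted transports along the block contours are within `¼` of `1` (`N ≤ 21`): unitary by
r05's `wframe_mem_unitaryUnits` ((22)–(23)), and `det exp[Σ_r L^{−d} log W_r] = exp Σ_r L^{−d} Tr log W_r = 1` since `Tr log W_r = 0` (Route A, (26)).
[cite: Balaban1985Averaging, (82) p.30, (20)–(26) pp.21–22] -/
theorem wframe_mem_specialUnitaryUnits (hN : N ≤ 21) (L : ℕ) {V₀ W : LSite d → Fin d → (Matrix (Fin N) (Fin N) ℂ)ˣ}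
    (hV₀ : ∀ x κ, V₀ x κ ∈ specialUnitaryUnits (Fin N)) (hW : ∀ x κ, W x κ ∈ specialUnitaryUnits (Fin N)) (y : LSite d)
    (hsmall : ∀ r : Fin d → Fin L, ‖((tHol V₀ W y (treeWord (boxVec L r)) : (Matrix (Fin N) (Fin N) ℂ)ˣ) : Matrix (Fin N) (Fin N) ℂ) - 1‖ ≤ 1 / 4) :
    wframe L V₀ W y ∈ specialUnitaryUnits (Fin N) := by
  letI : CStarAlgebra (Matrix (Fin N) (Fin N) ℂ) := B10Eq29TubeLine.cstarAlgebraMatrix N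
  have hU : wframe L V₀ W y ∈ B7Prop2Explicit.unitaryUnits (Matrix (Fin N) (Fin N) ℂ) :=
    wframe_mem_unitaryUnits L (fun x κ => specialUnitaryUnits_le_unitaryUnits (hV₀ x κ))
      (fun x κ => specialUnitaryUnits_le_unitaryUnits (hW x κ)) y hsmall
  have htr : ∀ r : Fin d → Fin L,
      (mlog ((tHol V₀ W y (treeWord (boxVec L r)) : (Matrix (Fin N) (Fin N) ℂ)ˣ) : Matrix (Fin N) (Fin N) ℂ)).trace = 0 := fun r => by
    refine trace_mlog_eq_zero_of_neg_log (Matrix.mem_specialUnitaryGroup_iff.1 (tHol_mem_specialUnitaryUnits hV₀ hW y _)).2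
      ((hsmall r).trans_lt (by norm_num)) (lt_of_le_of_lt ?_ (card_mul_neg_log_lt_two_pi hN (le_refl (1 / 4 : ℝ))))
    exact mul_le_mul_of_nonneg_left (neg_log_one_sub_mono (hsmall r) (by norm_num)) (Nat.cast_nonneg _)
  have hX : (Fcov L V₀ W y).trace = 0 := by
    unfold Fcov
    rw [Matrix.trace_sum]
    exact Finset.sum_eq_zero fun r _ => by rw [Matrix.trace_smul, htr r, smul_zero]
  rw [mem_specialUnitaryUnits, Matrix.mem_specialUnitaryGroup_iff]
  refine ⟨hU, ?_⟩
  show ((expUnit (Fcov L V₀ W y) : (Matrix (Fin N) (Fin N) ℂ)ˣ) : Matrix (Fin N) (Fin N) ℂ).det = 1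
  rw [val_expUnit, det_exp_eq_exp_trace, hX, exp_zero]

/-! ## §2 The tower: `U̿₁ʲ`, the frames `v_j` and print's gauge transformation `u = glev` are `SU(N)`-valued -/

section Tower

variable [NeZero N] {L k : ℕ} {U₀ : LSite d → Fin d → (Matrix (Fin N) (Fin N) ℂ)ˣ} {B : LSite d → Fin d → Matrix (Fin N) (Fin N) ℂ} {α₀ αP b : ℝ}
  (hN : N ≤ 21) (hd : 1 ≤ d) (hL : 2 ≤ L)
  (hU₀ : ∀ x κ, U₀ x κ ∈ specialUnitaryUnits (Fin N)) (hBu : ∀ x κ, expCfg B x κ ∈ specialUnitaryUnits (Fin N))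
  (hα : 0 < α₀) (hα3 : C0 d * α₀ ≤ 1 / 3) (hα4 : 4 * α₀ ≤ c2' d L) (h52 : pdev U₀ < α₀ * (((L : ℝ) ^ k)⁻¹) ^ 2)
  (hb : 0 ≤ b) (hB : ∀ x κ, ‖B x κ‖ ≤ b)
  (hsmall : Real.exp (4 * (800 * ((d : ℝ) + 1) ^ 2 * ((d : ℝ) + 4)) * α₀)
    * (1 + 8 * (131072 * ((d : ℝ) + 1) ^ 2) * ((L : ℝ) ^ k * b)) ≤ 2)
  (hc₃ : 2 * ((L : ℝ) ^ k * b) ≤ c3 d L) (hsm : 2048 * (d : ℝ) * ((L : ℝ) ^ k * b) ≤ 1)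
  (hαP : 0 < αP) (hαP3 : C0 d * αP ≤ 1 / 3) (hαP2 : 2 * αP ≤ c2' d L)
  (hP : pdev (expCfg B * U₀) < αP * (((L : ℝ) ^ k)⁻¹) ^ 2)

include hN hL hU₀ hα hα3 hα4 h52 in
/-- All averaged backgrounds `Ū₀ʲ`, `j ≤ k`, are `SU(N)`-valued (`avgIter_mem` for `G = SU(N)`, `avgClosed_specialUnitary_of_le_twentyone`).
[cite: Balaban1985Averaging, (52)–(53) p.26; Balaban1985RegularSpaces, (1.139) p.100] -/
theorem avgIter_mem_specialUnitaryUnits : ∀ j ≤ k, ∀ (x : LSite d) (κ : Fin d), avgIter L U₀ j x κ ∈ specialUnitaryUnits (Fin N) :=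
  avgIter_mem L hL (avgClosed_specialUnitary_of_le_twentyone hN d L) k U₀ hU₀ hα hα3 (by linarith) h52

include hN hL hU₀ hBu hαP hαP3 hαP2 hP in
/-- The same for the product configuration `U₁U₀`, `U₁ = e^{B}`, under its own window (1.141). [cite: Balaban1985Averaging, (52)–(53) p.26; Balaban1985RegularSpaces, (1.141) p.100] -/
theorem avgIter_mul_mem_specialUnitaryUnits :
    ∀ j ≤ k, ∀ (x : LSite d) (κ : Fin d), avgIter L (expCfg B * U₀) j x κ ∈ specialUnitaryUnits (Fin N) :=
  avgIter_mem L hL (avgClosed_specialUnitary_of_le_twentyone hN d L) k (expCfg B * U₀)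
    (fun x κ => by rw [Pi.mul_apply]; exact (specialUnitaryUnits (Fin N)).mul_mem (hBu x κ) (hU₀ x κ)) hαP hαP3 hαP2 hP

include hN hd hL hU₀ hBu hα hα3 hα4 h52 hb hB hsmall hc₃ hsm hαP hαP3 hαP2 hP in
/-- **`U̿₁ʲ` (90)∕(91) AND THE FRAMES `v_j` (97) ARE `SU(N)`-VALUED, `j ≤ k`** — r05's induction (`dbavgCovIter_vcov_mem_unitaryUnits`) with `SU(N)` in place of `U(𝔸)`:
the frame step is `wframe_mem_specialUnitaryUnits` ∘ `twist_le_quarter`, the average step is (89) solved through (93) (`tild_eq_of_mgauge`) and (92)∕(97)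
(`tildIter_eq_mgauge`). [cite: Balaban1985Averaging, (89)–(92) p.31, (97) p.32, (82) p.30] -/
theorem dbavgCovIter_vcov_mem_specialUnitaryUnits :
    ∀ j ≤ k, (∀ (z : LSite d) (κ : Fin d), dbavgCovIter L U₀ (expCfg B) j z κ ∈ specialUnitaryUnits (Fin N)) ∧
      ∀ z : LSite d, vcov L U₀ (expCfg B) j z ∈ specialUnitaryUnits (Fin N) := by
  letI : CStarAlgebra (Matrix (Fin N) (Fin N) ℂ) := B10Eq29TubeLine.cstarAlgebraMatrix N
  have hU₀' : ∀ x κ, U₀ x κ ∈ B7Prop2Explicit.unitaryUnits (Matrix (Fin N) (Fin N) ℂ) := fun x κ =>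
    specialUnitaryUnits_le_unitaryUnits (hU₀ x κ)
  intro j
  induction j with
  | zero =>
    intro _
    exact ⟨fun z κ => by rw [dbavgCovIter_zero]; exact hBu z κ,
      fun z => by rw [vcov_zero]; exact (specialUnitaryUnits (Fin N)).one_mem⟩
  | succ j ih =>
    intro hj1
    have hjk : j < k := Nat.lt_of_succ_le hj1
    obtain ⟨hW, hv⟩ := ih hjk.le
    have hV₀ := avgIter_mem_specialUnitaryUnits hN hL hU₀ hα hα3 hα4 h52 j hjk.le
    have hfr : ∀ y : LSite d, wframe L (avgIter L U₀ j) (dbavgCovIter L U₀ (expCfg B) j) y ∈ specialUnitaryUnits (Fin N) := fun y =>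
      wframe_mem_specialUnitaryUnits hN L hV₀ hW y
        (fun r => twist_le_quarter hd hL hU₀' hα hα3 hα4 h52 hb hB hsmall hc₃ hsm hjk y r)
    refine ⟨fun z κ => ?_, fun z => ?_⟩
    · have h1 : avgIter L (expCfg B * U₀) (j + 1) z κ ∈ specialUnitaryUnits (Fin N) :=
        avgIter_mul_mem_specialUnitaryUnits hN hL hU₀ hBu hαP hαP3 hαP2 hP (j + 1) hj1 z κ
      have h2 : avgIter L U₀ (j + 1) z κ ∈ specialUnitaryUnits (Fin N) :=
        avgIter_mem_specialUnitaryUnits hN hL hU₀ hα hα3 hα4 h52 (j + 1) hj1 z κ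
      have htild : tild L (avgIter L U₀ j) (tildIter L U₀ (expCfg B) j) ((L : ℤ) • z) κ ∈ specialUnitaryUnits (Fin N) := by
        rw [tild_apply, tildIter_mul]
        exact (specialUnitaryUnits (Fin N)).mul_mem h1 ((specialUnitaryUnits (Fin N)).inv_mem h2)
      have hbavg : bavg L (avgIter L U₀ j) ((L : ℤ) • z) κ ∈ specialUnitaryUnits (Fin N) := h2
      rw [dbavgCovIter_succ, dbavgCov_apply,
        tild_eq_of_mgauge L (avgIter L U₀ j) (dbavgCovIter L U₀ (expCfg B) j) (vcov L U₀ (expCfg B) j),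
        ← tildIter_eq_mgauge L U₀ (expCfg B) j]
      refine (specialUnitaryUnits (Fin N)).mul_mem ((specialUnitaryUnits (Fin N)).mul_mem ((specialUnitaryUnits (Fin N)).inv_mem (hfr _)) ?_)
        (Rc_mem_specialUnitaryUnits hbavg (hfr _))
      exact (specialUnitaryUnits (Fin N)).mul_mem
        ((specialUnitaryUnits (Fin N)).mul_mem ((specialUnitaryUnits (Fin N)).inv_mem (hv _)) htild)
        (Rc_mem_specialUnitaryUnits hbavg (hv _))
    · rw [vcov_succ]
      exact (specialUnitaryUnits (Fin N)).mul_mem (hv _) (hfr _)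

include hN hd hL hU₀ hBu hα hα3 hα4 h52 hb hB hsmall hc₃ hsm hαP hαP3 hαP2 hP in
/-- **PRINT'S GAUGE TRANSFORMATION `u` IS `SU(N)`-VALUED AT EVERY LEVEL**: `glev … k j x ∈ SU(N)` for `j ≤ k` ((87) at the top: `v_k⁻¹`; (76) below: rotations of products
of the frames and of the averages), r05's `glev_mem_unitaryUnits` with the determinant. [cite: Balaban1985Averaging, (76)–(77) pp.29–30, (87) p.31; Balaban1985RegularSpaces, p.81, p.100] -/
theorem glev_mem_specialUnitaryUnits (hL1 : 1 ≤ L) :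
    ∀ j ≤ k, ∀ x : LSite d, glev L hL1 U₀ (expCfg B) k j x ∈ specialUnitaryUnits (Fin N) := by
  suffices h : ∀ m j : ℕ, j + m = k → ∀ x : LSite d, glev L hL1 U₀ (expCfg B) k j x ∈ specialUnitaryUnits (Fin N) by
    intro j hj x
    exact h (k - j) j (by omega) x
  intro m
  induction m with
  | zero =>
    intro j hjk x
    have hj : j = k := by omega
    rw [hj, glev_top, wrec_eq_vcov]
    exact (specialUnitaryUnits (Fin N)).inv_mem
      ((dbavgCovIter_vcov_mem_specialUnitaryUnits hN hd hL hU₀ hBu hα hα3 hα4 h52 hb hB hsmall hc₃ hsm hαP hαP3 hαP2 hP k le_rfl).2 x)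
  | succ m ih =>
    intro j hjm x
    have hjk : j < k := by omega
    have hV₀ := avgIter_mem_specialUnitaryUnits hN hL hU₀ hα hα3 hα4 h52 j hjk.le
    have hV₁ := avgIter_mul_mem_specialUnitaryUnits hN hL hU₀ hBu hαP hαP3 hαP2 hP j hjk.le
    rw [glev_of_lt L hL1 U₀ (expCfg B) hjk]
    refine Rc_mem_specialUnitaryUnits ((specialUnitaryUnits (Fin N)).inv_mem (hol_mem_of hV₀ _ _))
      ((specialUnitaryUnits (Fin N)).mul_mem (ih (j + 1) (by omega) _) ?_)
    unfold tHol
    rw [tildIter_mul]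
    exact (specialUnitaryUnits (Fin N)).mul_mem (hol_mem_of hV₁ _ _) ((specialUnitaryUnits (Fin N)).inv_mem (hol_mem_of hV₀ _ _))

end Tower

/-! ## §3 At the T³ objects: (σ1) and the Σ_k bridge under the Prop. 7 windows -/

section T3

open Literature.MathematicalPhysics.QuantumFieldTheory.Balaban1983to89.T3ContinuumYM3Torus
open Literature.MathematicalPhysics.QuantumFieldTheory.Balaban1983to89.T3LevelShift (siteShift)
open Literature.MathematicalPhysics.QuantumFieldTheory.Balaban1983to89.T3UnitLawDensityEML (ℰp)
open Literature.MathematicalPhysics.QuantumFieldTheory.Balaban1983to89.T3TiltDescent (descendTo)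
open Literature.MathematicalPhysics.QuantumFieldTheory.Balaban1983to89.T3PrintedRegularOrbits (sites_eq)
open B10Eq27TorusAxialLog (pull pull_apply transl unitsField toUField val_unitsField)
open T3SectALandauChart (emb15)
open Summit.QuantumFields.YangMills.Theorems.Prop7SPrint (basePt IsAxialPrint RestrictedPrint AvgCondPrint)
open Summit.QuantumFields.YangMills.Theorems.Prop7AxialReprPrint (pull_toUField_mem)
open Summit.QuantumFields.YangMills.Theorems.Prop7ChartSigmaT3 (pull_emb15 avgCondPrint_of_restrictedAxial_of_eq137cov_canonical)
open Summit.QuantumFields.YangMills.Theorems.Prop7ChartSigmaT3Descent (exists_restrictedAxial_of_glev_mem)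

variable (F : T3Family) {n K : ℕ} (h : n ≤ K)

/-- **`U₁♯ = e^{B♯}` with `B♯ = iX♯`**: the based pullback of `U₁ = e^{iX}` (bondwise) is `expCfg` of the pulled-back exponent — the shape r05's tower reads.
[cite: Balaban1985Variational, (19) p.281; Balaban1985RegularSpaces, (1.3) p.77] -/
theorem pull_eq_expCfg_of_exp (U₁ : GaugeField (F.P K) 0 (Matrix.specialUnitaryGroup (Fin 2) ℂ)) (X : PBond (F.P K) 0 → Matrix (Fin 2) (Fin 2) ℂ)
    (hU₁ : ∀ b : PBond (F.P K) 0, ((U₁ b : Matrix.specialUnitaryGroup (Fin 2) ℂ) : Matrix (Fin 2) (Fin 2) ℂ) = exp (Complex.I • X b))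
    (x₀ : Site (F.P K) 0) :
    pull (unitsField (toUField U₁)) x₀ = expCfg (fun z κ => Complex.I • X ⟨transl x₀ z, κ⟩) := by
  funext z κ
  apply Units.ext
  rw [pull_apply, val_unitsField]
  show ((U₁ ⟨transl x₀ z, κ⟩ : Matrix.specialUnitaryGroup (Fin 2) ℂ) : Matrix (Fin 2) (Fin 2) ℂ) = ((expUnit (Complex.I • X ⟨transl x₀ z, κ⟩) : (Matrix (Fin 2) (Fin 2) ℂ)ˣ) : Matrix (Fin 2) (Fin 2) ℂ)
  rw [val_expUnit, hU₁]

/-- **(σ1) AT THE T³ OBJECTS UNDER THE PROP. 7 WINDOWS** ([B11] p.299 «we apply to it a gauge transformation u satisfying R̄₀u = 1 on Λ_j and such that (U₁U₀)^u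
satisfies the axial gauge conditions»): for `U₁ = e^{iX}` bondwise, with the windows of r05's tower READ ON THE BASED PULLBACKS — (1.139) `pdev U₀♯ < α₀L^{−2k}`
(⇐ `RegPr`, `Prop7AxialReprPrint.inAk_pull_of_regPr`∕`pdev_pull_lt`), `‖X‖ ≤ b` with `2048·d·Lᵏb ≤ 1` (the size (19)), `hsmall`, `hc₃`, and (1.141) for `(U₁U₀)♯` — there is a
torus gauge transformation `u`, (1.29)-RESTRICTED relative to `U₀`, with `(U₁U₀)^u` in the AXIAL GAUGE (1.19): §2 ∘ `Prop7ChartSigmaT3Descent.exists_restrictedAxial_of_glev_mem`.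
[cite: Balaban1985Variational, (19)–(20) p.281, p.299; Balaban1985RegularSpaces, Prop. 7 p.100, (1.19) p.79, (1.29) p.81; Balaban1985Averaging, (77)–(87) pp.30–31] -/
theorem exists_restrictedAxial_of_windows (U₀ U₁ : GaugeField (F.P K) 0 (Matrix.specialUnitaryGroup (Fin 2) ℂ))
    (X : PBond (F.P K) 0 → Matrix (Fin 2) (Fin 2) ℂ)
    (hU₁ : ∀ b : PBond (F.P K) 0, ((U₁ b : Matrix.specialUnitaryGroup (Fin 2) ℂ) : Matrix (Fin 2) (Fin 2) ℂ) = exp (Complex.I • X b))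
    {α₀ αP b : ℝ} (hα : 0 < α₀) (hα3 : C0 (F.P K).d * α₀ ≤ 1 / 3) (hα4 : 4 * α₀ ≤ c2' (F.P K).d (F.P K).L)
    (h52 : pdev (pull (unitsField (toUField U₀)) (basePt F n K)) < α₀ * ((((F.P K).L : ℝ) ^ (K - n))⁻¹) ^ 2)
    (hb : 0 ≤ b) (hB : ∀ bd : PBond (F.P K) 0, ‖X bd‖ ≤ b)
    (hsmall : Real.exp (4 * (800 * (((F.P K).d : ℝ) + 1) ^ 2 * (((F.P K).d : ℝ) + 4)) * α₀)
      * (1 + 8 * (131072 * (((F.P K).d : ℝ) + 1) ^ 2) * (((F.P K).L : ℝ) ^ (K - n) * b)) ≤ 2)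
    (hc₃ : 2 * (((F.P K).L : ℝ) ^ (K - n) * b) ≤ c3 (F.P K).d (F.P K).L) (hsm : 2048 * ((F.P K).d : ℝ) * (((F.P K).L : ℝ) ^ (K - n) * b) ≤ 1)
    (hαP : 0 < αP) (hαP3 : C0 (F.P K).d * αP ≤ 1 / 3) (hαP2 : 2 * αP ≤ c2' (F.P K).d (F.P K).L)
    (hP : pdev (pull (unitsField (toUField (emb15 U₀ U₁))) (basePt F n K)) < αP * ((((F.P K).L : ℝ) ^ (K - n))⁻¹) ^ 2) :
    ∃ u : GaugeTransf (F.P K) 0 (Matrix.specialUnitaryGroup (Fin 2) ℂ),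
      RestrictedPrint F n K U₀ u ∧ IsAxialPrint F n K U₀ (GaugeField.gaugeAct u (emb15 U₀ U₁)) := by
  have hL : 2 ≤ (F.P K).L := (F.P K).hL.2
  have hL1 : 1 ≤ (F.P K).L := le_trans (by norm_num) hL
  have hd : 1 ≤ (F.P K).d := by show 1 ≤ 3; norm_num
  have hexp := pull_eq_expCfg_of_exp F U₁ X hU₁ (basePt F n K)
  refine exists_restrictedAxial_of_glev_mem F hL1 U₀ U₁ fun z => ?_
  rw [hexp]
  have hU₀ : ∀ z' κ, pull (unitsField (toUField U₀)) (basePt F n K) z' κ ∈ specialUnitaryUnits (Fin 2) := fun z' κ => pull_toUField_mem U₀ _ z' κ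
  have hBu : ∀ z' κ, expCfg (fun z κ => Complex.I • X ⟨transl (basePt F n K) z, κ⟩) z' κ ∈ specialUnitaryUnits (Fin 2) := fun z' κ => by
    rw [← hexp]; exact pull_toUField_mem U₁ _ z' κ
  have hB' : ∀ (z' : LSite (F.P K).d) (κ : Fin (F.P K).d), ‖Complex.I • X ⟨transl (basePt F n K) z', κ⟩‖ ≤ b := fun z' κ => by
    rw [norm_smul, Complex.norm_I, one_mul]; exact hB _
  have hP' : pdev (expCfg (fun z κ => Complex.I • X ⟨transl (basePt F n K) z, κ⟩) * pull (unitsField (toUField U₀)) (basePt F n K))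
      < αP * ((((F.P K).L : ℝ) ^ (K - n))⁻¹) ^ 2 := by
    rw [← hexp, ← pull_emb15]; exact hP
  exact glev_mem_specialUnitaryUnits (by norm_num) hd hL hU₀ hBu hα hα3 hα4 h52 hb hB' hsmall hc₃ hsm hαP hαP3 hαP2 hP' hL1 0 (Nat.zero_le _) z

/-- **THE Σ_k BRIDGE FROM THE WINDOWS AND (1.37)^cov ALONE**: print's (20) in surface form `Prop7SPrint.AvgCondPrint F n K h V U₀ X` («∃ (1.29)-restricted u, (e^{iX}U₀)^u ∈
Ax_k(𝔅_k, U₀) ∩ 𝔅_k(𝔅_k, V)») follows from the Prop. 7 windows on the based pullbacks ((1.139) for `U₀`, the size of `X`, (1.141) for `e^{iX}U₀`) and the equation (1.37)^cov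
for `D_{n,K}(e^{iX}U₀)` — no gauge-fixing letter is displayed any more (`exists_restrictedAxial_of_windows` ∘ `Prop7ChartSigmaT3.avgCondPrint_of_restrictedAxial_of_eq137cov_canonical`).
[cite: Balaban1985Variational, (19)–(20) p.281, p.299; Balaban1985RegularSpaces, Prop. 7 p.100, (1.28)–(1.31) pp.81–82] -/
theorem avgCondPrint_of_windows_of_eq137cov (V : GaugeField (F.P n) 0 (Matrix.specialUnitaryGroup (Fin 2) ℂ))
    (U₀ : GaugeField (F.P K) 0 (Matrix.specialUnitaryGroup (Fin 2) ℂ)) (X : PBond (F.P K) 0 → Matrix (Fin 2) (Fin 2) ℂ)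
    {α₀ αP b : ℝ} (hα : 0 < α₀) (hα3 : C0 (F.P K).d * α₀ ≤ 1 / 3) (hα4 : 4 * α₀ ≤ c2' (F.P K).d (F.P K).L)
    (h52 : pdev (pull (unitsField (toUField U₀)) (basePt F n K)) < α₀ * ((((F.P K).L : ℝ) ^ (K - n))⁻¹) ^ 2)
    (hb : 0 ≤ b) (hB : ∀ bd : PBond (F.P K) 0, ‖X bd‖ ≤ b)
    (hsmall : Real.exp (4 * (800 * (((F.P K).d : ℝ) + 1) ^ 2 * (((F.P K).d : ℝ) + 4)) * α₀)
      * (1 + 8 * (131072 * (((F.P K).d : ℝ) + 1) ^ 2) * (((F.P K).L : ℝ) ^ (K - n) * b)) ≤ 2)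
    (hc₃ : 2 * (((F.P K).L : ℝ) ^ (K - n) * b) ≤ c3 (F.P K).d (F.P K).L) (hsm : 2048 * ((F.P K).d : ℝ) * (((F.P K).L : ℝ) ^ (K - n) * b) ≤ 1)
    (hαP : 0 < αP) (hαP3 : C0 (F.P K).d * αP ≤ 1 / 3) (hαP2 : 2 * αP ≤ c2' (F.P K).d (F.P K).L)
    (hP : ∀ U₁ : GaugeField (F.P K) 0 (Matrix.specialUnitaryGroup (Fin 2) ℂ),
      (∀ b : PBond (F.P K) 0, ((U₁ b : Matrix.specialUnitaryGroup (Fin 2) ℂ) : Matrix (Fin 2) (Fin 2) ℂ) = exp (Complex.I • X b)) →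
        pdev (pull (unitsField (toUField (emb15 U₀ U₁))) (basePt F n K)) < αP * ((((F.P K).L : ℝ) ^ (K - n))⁻¹) ^ 2)
    (h137 : ∀ U₁ : GaugeField (F.P K) 0 (Matrix.specialUnitaryGroup (Fin 2) ℂ),
      (∀ b : PBond (F.P K) 0, ((U₁ b : Matrix.specialUnitaryGroup (Fin 2) ℂ) : Matrix (Fin 2) (Fin 2) ℂ) = exp (Complex.I • X b)) →
        ∀ c : PBond (F.P n) 0,
          unitsField (toUField (descendTo F ℰp n K h (emb15 U₀ U₁))) c
            = wrec (F.P K).L (pull (unitsField (toUField U₀)) (basePt F n K)) (pull (unitsField (toUField U₁)) (basePt F n K)) (K - n)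
                (fun μ => (((siteShift (sites_eq F n K h) c.src) μ).val : ℤ))
              * unitsField (toUField V) c
              * (wrec (F.P K).L (pull (unitsField (toUField U₀)) (basePt F n K)) (pull (unitsField (toUField U₁)) (basePt F n K)) (K - n)
                (fun μ => (((siteShift (sites_eq F n K h) c.tgt) μ).val : ℤ)))⁻¹) :
    AvgCondPrint F n K h V U₀ X :=
  avgCondPrint_of_restrictedAxial_of_eq137cov_canonical F h V U₀ X
    (fun U₁ hU₁ => exists_restrictedAxial_of_windows F U₀ U₁ X hU₁ hα hα3 hα4 h52 hb hB hsmall hc₃ hsm hαP hαP3 hαP2 (hP U₁ hU₁)) h137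

end T3

end Summit.QuantumFields.YangMills.Theorems.Prop7ChartSigmaT3GlevSU

end
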